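import Summits.RiemannHypothesis.RiemannHypothesis.Theorems.HandoffGaussTail
import Summits.RiemannHypothesis.RiemannHypothesis.Theorems.WeilGroundStateGroundStatesConvergeToXiHarmonicClosure
import Literature.NumberTheory.LFunctions.WeilMellinInversion
import Literature.NumberTheory.LFunctions.RiemannXiHadamardProduct
import Literature.NumberTheory.LFunctions.ZetaZerosProofs
import Literature.Barriers.RiemannHypothesis.DeBrangesPositivityHE
import Mathlib.Analysis.Calculus.IteratedDeriv.Lemmas
import HarnessLib

/-!
# HANDOFF — «Hardy rigidity» over the harmonic predicate forces simple zeros (file XX-b)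

Cell `rh-explicit`, TRACK «HANDOFF», seat theory-1 (H-T), gen18. RH-free; crux line `GroundStatesConvergeToXi` + XX-a `HandoffGaussTail`. No defs.

THE OFFER (idea-3 g24 §G24-3, I l.5907): H-RIG(D) — a WEIL-HARMONIC `v` (tree predicate
`∀ g, IsWeilTest g → weilFunctional (weilConv v (weilReflect g)) = 0`) with `‖v(t)‖ ≤ C(1 + e^{2|t|})^D e^{|t|/2 − πe^{2|t|}}`
lies in the theta–Hermite ladder (`v̂ = P·ξ`, `deg P ≤ D − 2`; at `D = 2`, `v = c·Φ`). idea-3 g25 (I l.5966, HOME-only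
Lean file) typed the VALUE version `HRigValue`, the divisibility version `HRig` (`ξ ∣ v̂`), the bridge
`HarmonicDivides`, and — independently, same night — the DERIVED `HRigValueForcesSimpleZeros`. Here, KERNEL:

* §3 THE DICTIONARY `harmonic_iff_weilMellin_eq_zero`: on the strong exponential class, Weil-harmonic ⟺
  `v̂(ρ) = 0` at every non-trivial zero — VALUES ONLY (⟹ the tree's `harmonic_closure`; ⟸ the class explicit
  formula read backwards); Weil's functional never sees `v̂′(ρ)`.
* §4 THE WITNESS `exists_harmonic_gaussTail_not_const_mul_phi`: if `ξ(ρ₀) = ξ′(ρ₀) = 0` in the open strip, divide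
  `Φ̂ = ξ` ONCE (`stub_mellin_divide_strong`): `Ĝ = ξ/(s − ρ₀)` still vanishes on the whole zero set (at `ρ₀` by
  continuity), so `v := G + G(−·)` is smooth, EVEN, strong-class, WEIL-HARMONIC, has Φ's own order-2 rate-`π` tail
  (XX-a), and `(s − ρ₀)(s − (1 − ρ₀))·v̂ = (2ρ₀ − 1)·ξ`: a POLE of `v̂/ξ` — `v̂ ≠ c·ξ`, `v ∉ ℂΦ`, `v̂ ≠ R·ξ` near `ρ₀`
  for ANY `R` continuous at `ρ₀` (`not_exists_continuous_quotient`): no ladder of any order, no `ξ ∣ v̂`.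
* §5 `not_hardyRigidity_of_multiple_zero`, **`simpleZerosConjecture_of_hardyRigidity`**: H-RIG(2) over the harmonic
  predicate — even WITH the extra hypotheses smooth / even / strong-class — IMPLIES `SimpleZerosConjecture`.
* §6 idea-3 g25's `HRigValueForcesSimpleZeros` PROVED verbatim; its bridge `HarmonicDivides 2` refuted at a multiple
  zero (the converse under simple zeros is file XX-c `HandoffHarmonicDivides`: the bridge IS the simple-zeros clause).

READING (LOGIC-CARD 4⁗′ / HANDOFF-STATEMENT §J.33). H-RIG as first offered is NOT an RH-free classical lemma:
over `{harmonic}` it is ≥ SZC, for every order `D ≥ 2` and every conclusion «`v̂ ∈ ξ·𝒪`». The classical content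
(Hardy 1933 / BDJ 2003, or g25's Literature-free route B″) starts from «`v̂ = m·ξ`, `m` ENTIRE» — g25's `HRig`,
untouched here, SZC-free. For X2: identifying a tight weak limit with `c·Φ` through tails needs, besides the tail
class (≥ RH, G24 (H6)), an input fixing `v̂` to order `m(ρ)` at multiple zeros — finite-window minimality or SZC
(g25's CAVEAT H8, now with a kernel witness). Neither of SZC, RH is known to imply the other; nothing here bears
on the truth of RH.

References: idea-3 PART G24 §G24-3 / G25; Hardy 1933 Thm 1 (arXiv:2507.08370 p. 1), BDJ 2003 Thm 1.1 [handoff-lit §95];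
Berndt–Knopp pp. 65–66 [I l.5966]; tree `…WeakLimitHarmonic`, `…HarmonicClosure`, `…StubMellinDivideStrong`; RHWave0.
-/

set_option linter.dupNamespace false  -- the mandated namespace repeats `RiemannHypothesis`

noncomputable section

open Set Filter MeasureTheory Complex
open scoped Topology Real ComplexConjugate
open Literature.NumberTheory.LFunctions
open Summit.RiemannHypothesis.RiemannHypothesis.Theorems.GroundStatesConvergeToXi
open Summit.RiemannHypothesis.RiemannHypothesis.Theorems.HandoffGaussTail

namespace Summit.RiemannHypothesis.RiemannHypothesis.Theorems.HandoffHardyRigidity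

/-! ## §3 Harmonicity pins VALUES: the converse of the tree's `harmonic_closure` -/

/-- A strong-class function lies in the weighted class `∫ ‖v‖ e^{(3/4)|t|} < ∞` of `harmonic_closure`. [folklore] -/
theorem integrable_weight_of_strongClass {v : ℝ → ℂ} (hv : ContDiff ℝ (⊤ : ℕ∞) v)
    (hvb : ∀ k : ℕ, ∃ C : ℝ, ∀ t : ℝ, ‖iteratedDeriv k v t‖ ≤ C * Real.exp (-(1 * |t|))) :
    Integrable (fun t : ℝ => ‖v t‖ * Real.exp (3 / 4 * |t|)) := by
  obtain ⟨C₀, hC₀⟩ := hvb 0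
  have hvm : AEStronglyMeasurable v volume := hv.continuous.aestronglyMeasurable
  have hgI : Integrable (fun t : ℝ => C₀ * Real.exp (-(1 / 4) * |t|)) :=
    (Literature.Analysis.Complex.integrable_exp_neg_mul_abs (by norm_num : (0:ℝ) < 1 / 4)).const_mul C₀
  refine hgI.mono' (hvm.norm.mul (by fun_prop)) (ae_of_all _ fun t => ?_)
  rw [Real.norm_eq_abs, abs_of_nonneg (by positivity)]
  have h0 := hC₀ t; rw [iteratedDeriv_zero] at h0
  calc ‖v t‖ * Real.exp (3 / 4 * |t|) ≤ C₀ * Real.exp (-(1 * |t|)) * Real.exp (3 / 4 * |t|) :=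
        mul_le_mul_of_nonneg_right h0 (Real.exp_pos _).le
    _ = C₀ * Real.exp (-(1 / 4) * |t|) := by rw [mul_assoc, ← Real.exp_add]; congr 2; ring

/-- **A function of the weighted class whose transform vanishes on the non-trivial zero SET is Weil-harmonic**
(VALUES only; `v` a.e.-measurable with `∫ ‖v‖ e^{b₁|t|} < ∞`, `b₁ > 1/2` — the hypotheses of the tree's converse
`harmonic_closure`): strong-class pairing `(v ⋆ g̃)^(ρ) = v̂(ρ)·conj ĝ(1 − conj ρ)` with the test's rate
`b₀ = min b₁ 1`, then the class explicit formula gives `W(v ⋆ g̃) = Σ' m(ρ)·0 = 0`. [folklore] -/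
theorem harmonic_of_weilMellin_eq_zero' {v : ℝ → ℂ} {b₁ : ℝ} (hvm : AEStronglyMeasurable v volume)
    (hb₁ : 1 / 2 < b₁) (hint : Integrable (fun t : ℝ => ‖v t‖ * Real.exp (b₁ * |t|)))
    (hzero : ∀ ρ : ℂ, ρ ∈ ZetaZeros.riemannZetaNontrivialZeros → weilMellin v ρ = 0)
    {g : ℝ → ℂ} (hg : IsWeilTest g) : weilFunctional (weilConv v (weilReflect g)) = 0 := by
  set b₀ : ℝ := min b₁ 1 with hb₀
  have hb₀h : 1 / 2 < b₀ := lt_min hb₁ (by norm_num)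
  have hgb : ∀ k : ℕ, ∃ C : ℝ, ∀ t : ℝ, ‖iteratedDeriv k g t‖ ≤ C * Real.exp (-(b₀ * |t|)) :=
    hExt_strong_of_isWeilTest hg (by linarith)
  obtain ⟨hFcd, hFbd, hFmel⟩ := stub_strongClass_pairing v g b₁ b₀ hvm hb₁ hint hg.1 hb₀h
    (min_le_left _ _) hgb
  obtain ⟨C, hC0, hC1, hC2⟩ := hExt_deriv_bounds_of_all hFbd
  obtain ⟨-, hsum⟩ := explicit_formula_expClass' _ C b₀ hFcd hb₀h hC0 hC1 hC2
  rw [← hsum]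
  refine (tsum_congr fun ρ => ?_).trans tsum_zero
  rw [hFmel ρ (ZetaZeros.riemannZetaNontrivialZeros.re_pos ρ.2).le
    (ZetaZeros.riemannZetaNontrivialZeros.re_lt_one ρ.2).le, hzero ρ ρ.2, zero_mul, mul_zero]

/-- **THE DICTIONARY: Weil-harmonicity pins VALUES at the zeros, nothing more.** On the weighted class
(`∫ ‖v‖ e^{b₁|t|} < ∞`, `b₁ > 1/2`), `W(v ⋆ g̃) = 0 ∀ tests g` ⟺ `v̂(ρ) = 0` at every non-trivial zero `ρ`
(⟹ the tree's `harmonic_closure`, ⟸ `harmonic_of_weilMellin_eq_zero'`); nothing is said about `v̂′(ρ)` at a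
multiple zero. [folklore] -/
theorem harmonic_iff_weilMellin_eq_zero' {v : ℝ → ℂ} {b₁ : ℝ} (hvm : AEStronglyMeasurable v volume)
    (hb₁ : 1 / 2 < b₁) (hint : Integrable (fun t : ℝ => ‖v t‖ * Real.exp (b₁ * |t|))) :
    (∀ g : ℝ → ℂ, IsWeilTest g → weilFunctional (weilConv v (weilReflect g)) = 0) ↔
      ∀ ρ : ℂ, ρ ∈ ZetaZeros.riemannZetaNontrivialZeros → weilMellin v ρ = 0 :=
  ⟨fun h _ hρ => harmonic_closure hvm hb₁ hint h hρ, fun h _ hg => harmonic_of_weilMellin_eq_zero' hvm hb₁ hint h hg⟩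

/-- The strong-class case (smooth, every derivative `O(e^{-|t|})`; `b₁ = 3/4`). [folklore] -/
theorem harmonic_of_weilMellin_eq_zero {v : ℝ → ℂ} (hv : ContDiff ℝ (⊤ : ℕ∞) v)
    (hvb : ∀ k : ℕ, ∃ C : ℝ, ∀ t : ℝ, ‖iteratedDeriv k v t‖ ≤ C * Real.exp (-(1 * |t|)))
    (hzero : ∀ ρ : ℂ, ρ ∈ ZetaZeros.riemannZetaNontrivialZeros → weilMellin v ρ = 0)
    {g : ℝ → ℂ} (hg : IsWeilTest g) : weilFunctional (weilConv v (weilReflect g)) = 0 :=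
  harmonic_of_weilMellin_eq_zero' hv.continuous.aestronglyMeasurable (by norm_num : (1:ℝ) / 2 < 3 / 4)
    (integrable_weight_of_strongClass hv hvb) hzero hg

/-- The strong-class case of the dictionary. [folklore] -/
theorem harmonic_iff_weilMellin_eq_zero {v : ℝ → ℂ} (hv : ContDiff ℝ (⊤ : ℕ∞) v)
    (hvb : ∀ k : ℕ, ∃ C : ℝ, ∀ t : ℝ, ‖iteratedDeriv k v t‖ ≤ C * Real.exp (-(1 * |t|))) :
    (∀ g : ℝ → ℂ, IsWeilTest g → weilFunctional (weilConv v (weilReflect g)) = 0) ↔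
      ∀ ρ : ℂ, ρ ∈ ZetaZeros.riemannZetaNontrivialZeros → weilMellin v ρ = 0 :=
  harmonic_iff_weilMellin_eq_zero' hv.continuous.aestronglyMeasurable (by norm_num : (1:ℝ) / 2 < 3 / 4)
    (integrable_weight_of_strongClass hv hvb)

/-! ## §4 The witness at a multiple zero: dividing Riemann's kernel ONCE -/

/-- **Dividing `Φ̂ = ξ` once at a zero `ρ₀` of the open strip** (`stub_mellin_divide_strong` on Riemann's kernel:
strong class, rate `1`, `Φ̂ = ξ`): `G' = −(ρ₀ − ½)G − Φ`, `ξ(s) = (s − ρ₀)·Ĝ(s)` in the closed strip. [folklore] -/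
theorem exists_phi_div {ρ₀ : ℂ} (h0 : 0 < ρ₀.re) (h1 : ρ₀.re < 1) (hξ : riemannXi ρ₀ = 0) :
    ∃ G : ℝ → ℂ, ContDiff ℝ (⊤ : ℕ∞) G ∧
      (∀ k : ℕ, ∃ C : ℝ, ∀ t : ℝ, ‖iteratedDeriv k G t‖ ≤ C * Real.exp (-(1 * |t|))) ∧
      (∀ t, HasDerivAt G (-(ρ₀ - 1 / 2) * G t - (2 : ℂ) * LagariasMontague.Psic (2 * t)) t) ∧
      ∀ s : ℂ, 0 ≤ s.re → s.re ≤ 1 → riemannXi s = (s - ρ₀) * weilMellin G s := by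
  have hmel : weilMellin (fun t : ℝ => (2 : ℂ) * LagariasMontague.Psic (2 * t)) ρ₀ = 0 := by
    rw [stub_mellinXi stub_psiDecay.1 stub_psiDecay.2 ρ₀, hξ]
  obtain ⟨G, hGcd, hGb, hode, hdiv⟩ := stub_mellin_divide_strong _ 1 ρ₀ contDiff_phi (by norm_num)
    stub_phi_iteratedDeriv_envelope h0 h1 hmel
  refine ⟨G, hGcd, hGb, fun t => ?_, fun s hs0 hs1 => ?_⟩
  · have hd : HasDerivAt G (deriv G t) t :=
      ((hGcd.differentiable (by simp)).differentiableAt).hasDerivAt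
    rwa [hode t] at hd
  · rw [← stub_mellinXi stub_psiDecay.1 stub_psiDecay.2 s, hdiv s hs0 hs1]

/-- **A once-divided kernel at a MULTIPLE zero still vanishes on the whole zero set**: if `ξ(s) = (s − ρ₀)Ĝ(s)`
in the closed strip and `ξ′(ρ₀) = 0`, then `Ĝ = 0` at every zero of `ξ` in the open strip (at `ρ₀` by continuity). [folklore] -/
theorem weilMellin_div_eq_zero {G : ℝ → ℂ} {ρ₀ : ℂ} (hGc : Continuous G)
    (hGb : ∃ C : ℝ, ∀ t : ℝ, ‖G t‖ ≤ C * Real.exp (-(1 * |t|)))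
    (hdiv : ∀ s : ℂ, 0 ≤ s.re → s.re ≤ 1 → riemannXi s = (s - ρ₀) * weilMellin G s)
    (h0 : 0 < ρ₀.re) (h1 : ρ₀.re < 1) (hξ' : deriv riemannXi ρ₀ = 0)
    {s : ℂ} (hs0 : 0 < s.re) (hs1 : s.re < 1) (hξs : riemannXi s = 0) : weilMellin G s = 0 := by
  by_cases hs : s = ρ₀
  · subst hs
    have hξ0 : riemannXi s = 0 := hξs
    -- the slope of `ξ` at `s` tends to `ξ'(s) = 0` and agrees with `Ĝ` on a punctured neighbourhood
    have hslope : Tendsto (slope riemannXi s) (𝓝[≠] s) (𝓝 0) := by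
      rw [← hξ']
      exact hasDerivAt_iff_tendsto_slope.1 (differentiable_riemannXi s).hasDerivAt
    have hU : {z : ℂ | 0 < z.re ∧ z.re < 1} ∈ 𝓝 s :=
      (isOpen_Ioo.preimage Complex.continuous_re).mem_nhds ⟨h0, h1⟩
    have hev : slope riemannXi s =ᶠ[𝓝[≠] s] weilMellin G := by
      filter_upwards [mem_nhdsWithin_of_mem_nhds hU, self_mem_nhdsWithin] with z hz hne
      rw [slope_def_field, hξ0, sub_zero, hdiv z hz.1.le hz.2.le]
      field_simp [sub_ne_zero.2 hne]
    have hG0 : Tendsto (weilMellin G) (𝓝[≠] s) (𝓝 0) := hslope.congr' hev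
    have hGc' : Tendsto (weilMellin G) (𝓝[≠] s) (𝓝 (weilMellin G s)) :=
      (phiDiv_continuousAt_weilMellin hGc hGb h0 h1).tendsto.mono_left nhdsWithin_le_nhds
    exact tendsto_nhds_unique hGc' hG0
  · have h := hdiv s hs0.le hs1.le
    rw [hξs] at h
    exact (mul_eq_zero.1 h.symm).resolve_left (sub_ne_zero.2 hs)

/-- **THE WITNESS.** If `ξ(ρ₀) = ξ′(ρ₀) = 0` in the open strip (a MULTIPLE non-trivial zero of `ζ`), then
`v = G + G(−·)` (`Ĝ = ξ/(s − ρ₀)`) is smooth, EVEN, strong-class, has `Φ`'s own order-2 rate-EXACTLY-`π` tail, is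
WEIL-HARMONIC, and `(s − ρ₀)(s − (1 − ρ₀))·v̂ = (2ρ₀ − 1)·ξ` in the closed strip; `v̂ ≠ c·ξ`, `v ∉ ℂΦ`. [folklore] -/
theorem exists_harmonic_gaussTail_not_const_mul_phi {ρ₀ : ℂ} (h0 : 0 < ρ₀.re) (h1 : ρ₀.re < 1)
    (hξ : riemannXi ρ₀ = 0) (hξ' : deriv riemannXi ρ₀ = 0) :
    ∃ v : ℝ → ℂ, ContDiff ℝ (⊤ : ℕ∞) v ∧ (∀ t, v (-t) = v t) ∧
      (∀ k : ℕ, ∃ C : ℝ, ∀ t : ℝ, ‖iteratedDeriv k v t‖ ≤ C * Real.exp (-(1 * |t|))) ∧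
      (∃ C : ℝ, ∀ t : ℝ,
        ‖v t‖ ≤ C * (1 + Real.exp (2 * |t|)) ^ 2 * Real.exp (|t| / 2 - π * Real.exp (2 * |t|))) ∧
      (∀ g : ℝ → ℂ, IsWeilTest g → weilFunctional (weilConv v (weilReflect g)) = 0) ∧
      (∀ s : ℂ, 0 ≤ s.re → s.re ≤ 1 →
        (s - ρ₀) * (s - (1 - ρ₀)) * weilMellin v s = (2 * ρ₀ - 1) * riemannXi s) ∧
      (∀ c : ℂ, ¬ ∀ s : ℂ, 0 ≤ s.re → s.re ≤ 1 → weilMellin v s = c * riemannXi s) ∧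
      ∀ c : ℂ, ¬ ∀ t : ℝ, v t = c * ((2 : ℂ) * LagariasMontague.Psic (2 * t)) := by
  obtain ⟨G, hGcd, hGb, hGd, hdiv⟩ := exists_phi_div h0 h1 hξ
  have hGc : Continuous G := hGcd.continuous
  obtain ⟨C₀, hC₀'⟩ := hGb 0
  have hC₀ : ∀ t, ‖G t‖ ≤ C₀ * Real.exp (-(1 * |t|)) := fun t => by simpa using hC₀' t
  have hGzero : ∀ s : ℂ, 0 < s.re → s.re < 1 → riemannXi s = 0 → weilMellin G s = 0 :=
    fun s hs0 hs1 hξs => weilMellin_div_eq_zero hGc ⟨C₀, hC₀⟩ hdiv h0 h1 hξ' hs0 hs1 hξs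
  -- Mellin transforms in the closed strip
  have hGi : ∀ s : ℂ, 0 ≤ s.re → s.re ≤ 1 → Integrable fun t : ℝ => G t * cexp ((s - 1 / 2) * t) :=
    fun s hs0 hs1 => zsTrunc_integrable_mul_cexp hGc (by norm_num : (1:ℝ) / 2 < 1) hC₀ hs0 hs1
  have hC₀' : ∀ t, ‖G (-t)‖ ≤ C₀ * Real.exp (-(1 * |t|)) := fun t => by simpa using hC₀ (-t)
  have hGni : ∀ s : ℂ, 0 ≤ s.re → s.re ≤ 1 →
      Integrable fun t : ℝ => G (-t) * cexp ((s - 1 / 2) * t) :=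
    fun s hs0 hs1 => zsTrunc_integrable_mul_cexp (hGc.comp continuous_neg) (by norm_num : (1:ℝ) / 2 < 1)
      hC₀' hs0 hs1
  have hvmel : ∀ s : ℂ, 0 ≤ s.re → s.re ≤ 1 →
      weilMellin (fun t => G t + G (-t)) s = weilMellin G s + weilMellin G (1 - s) := by
    intro s hs0 hs1
    rw [← weilMellin_comp_neg G s]
    unfold weilMellin
    rw [← integral_add (hGi s hs0 hs1) (hGni s hs0 hs1)]
    congr 1 with t; ring
  set v : ℝ → ℂ := fun t => G t + G (-t) with hv
  -- smoothness, parity, strong class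
  have hGncd : ContDiff ℝ (⊤ : ℕ∞) (fun t => G (-t)) := hGcd.comp contDiff_neg
  have hvcd : ContDiff ℝ (⊤ : ℕ∞) v := hGcd.add hGncd
  have heven : ∀ t, v (-t) = v t := fun t => by simp only [hv, neg_neg]; ring
  have hvb : ∀ k : ℕ, ∃ C : ℝ, ∀ t : ℝ, ‖iteratedDeriv k v t‖ ≤ C * Real.exp (-(1 * |t|)) := by
    intro k
    obtain ⟨C, hC⟩ := hGb k
    refine ⟨C + C, fun t => ?_⟩
    have hGk : ContDiffAt ℝ k G t := (contDiff_infty.1 hGcd k).contDiffAt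
    have hGnk : ContDiffAt ℝ k (fun t => G (-t)) t := (contDiff_infty.1 hGncd k).contDiffAt
    rw [hv, iteratedDeriv_fun_add hGk hGnk, iteratedDeriv_comp_neg k G t]
    calc ‖iteratedDeriv k G t + (-1 : ℝ) ^ k • iteratedDeriv k G (-t)‖
        ≤ ‖iteratedDeriv k G t‖ + ‖(-1 : ℝ) ^ k • iteratedDeriv k G (-t)‖ := norm_add_le _ _
      _ = ‖iteratedDeriv k G t‖ + ‖iteratedDeriv k G (-t)‖ := by
          rw [norm_smul, norm_pow, norm_neg, norm_one, one_pow, one_mul]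
      _ ≤ C * Real.exp (-(1 * |t|)) + C * Real.exp (-(1 * |(-t)|)) := add_le_add (hC t) (hC (-t))
      _ = (C + C) * Real.exp (-(1 * |t|)) := by rw [abs_neg]; ring
  -- the sharp Gaussian tail passes from `Φ` to `G`, hence to `v`
  obtain ⟨K, -, hK⟩ := exists_norm_phi_le_sharp
  have hw : |(ρ₀ - 1 / 2 : ℂ).re| ≤ 1 / 2 := by
    rw [abs_le]; simp only [sub_re, one_div]; norm_num; constructor <;> linarith
  have hwb : |(ρ₀ - 1 / 2 : ℂ).re| < 1 := by linarith
  have htail := norm_le_gaussEnv_of_ode (w := ρ₀ - 1 / 2) continuous_phi hK hGd hC₀ hwb hw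
  set K' : ℝ := K / (2 * π - 9 / 2 - |(ρ₀ - 1 / 2 : ℂ).re|) with hK'
  -- the Mellin identity `(s − ρ₀)(s − (1 − ρ₀)) v̂(s) = (2ρ₀ − 1) ξ(s)` in the closed strip
  have hkey : ∀ s : ℂ, 0 ≤ s.re → s.re ≤ 1 →
      (s - ρ₀) * (s - (1 - ρ₀)) * weilMellin v s = (2 * ρ₀ - 1) * riemannXi s := by
    intro s hs0 hs1
    rw [hvmel s hs0 hs1]
    have h1 := hdiv s hs0 hs1
    have h2 := hdiv (1 - s) (by simp; linarith) (by simp; linarith)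
    rw [riemannXi_one_sub] at h2
    linear_combination -(s - (1 - ρ₀)) * h1 + (s - ρ₀) * h2
  -- `v̂ ≠ c·ξ` on the strip: evaluate the identity at `s = 1` and `s = 1/2`
  have hnotmel : ∀ c : ℂ, ¬ ∀ s : ℂ, 0 ≤ s.re → s.re ≤ 1 → weilMellin v s = c * riemannXi s := by
    intro c hvm
    have e1 := hkey 1 (by simp) (by simp)
    rw [hvm 1 (by simp) (by simp), riemannXi_one] at e1
    have e2 := hkey (1 / 2) (by norm_num) (by norm_num)
    rw [hvm (1 / 2) (by norm_num) (by norm_num)] at e2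
    have e2' : (1 / 2 - ρ₀) * (1 / 2 - (1 - ρ₀)) * c = 2 * ρ₀ - 1 :=
      mul_right_cancel₀ riemannXi_one_half_ne_zero (by linear_combination e2)
    have hc0 : c = 0 := by linear_combination 4 * (2 * e1 - e2')
    rw [hc0, mul_zero] at e2'
    have hρ : ρ₀ = 1 / 2 := by linear_combination -e2' / 2
    exact riemannXi_one_half_ne_zero (hρ ▸ hξ)
  refine ⟨v, hvcd, heven, hvb, ⟨K' + K', fun t => ?_⟩, fun g hg => ?_, hkey, hnotmel, fun c hc => ?_⟩
  · calc ‖v t‖ = ‖G t + G (-t)‖ := rfl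
      _ ≤ ‖G t‖ + ‖G (-t)‖ := norm_add_le _ _
      _ ≤ K' * ((1 + Real.exp (2 * |t|)) ^ 2 * Real.exp (|t| / 2 - π * Real.exp (2 * |t|))) +
          K' * ((1 + Real.exp (2 * |(-t)|)) ^ 2 * Real.exp (|(-t)| / 2 - π * Real.exp (2 * |(-t)|))) :=
          add_le_add (htail t) (htail (-t))
      _ = (K' + K') * (1 + Real.exp (2 * |t|)) ^ 2 * Real.exp (|t| / 2 - π * Real.exp (2 * |t|)) := by
          rw [abs_neg]; ring
  · -- harmonic: `v̂ = Ĝ + Ĝ(1 − ·)` vanishes on the whole non-trivial zero set (values!)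
    refine harmonic_of_weilMellin_eq_zero hvcd hvb (fun ρ hρ => ?_) hg
    have hρ0 := ZetaZeros.riemannZetaNontrivialZeros.re_pos hρ
    have hρ1 := ZetaZeros.riemannZetaNontrivialZeros.re_lt_one hρ
    have hξρ := riemannXi_eq_zero_of_mem_riemannZetaNontrivialZeros hρ
    rw [hvmel ρ hρ0.le hρ1.le, hGzero ρ hρ0 hρ1 hξρ,
      hGzero (1 - ρ) (by simp; linarith) (by simp; linarith) (by rw [riemannXi_one_sub]; exact hξρ), add_zero]
  · -- not a multiple of `Φ`: its transform would be `c·ξ` everywhere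
    refine hnotmel c fun s _ _ => ?_
    rw [funext hc, ← stub_mellinXi stub_psiDecay.1 stub_psiDecay.2 s]
    unfold weilMellin
    rw [← integral_const_mul]
    congr 1 with t; ring

/-- **No ladder member of ANY order: `v̂/ξ` has a genuine pole at `ρ₀`.** If `(s − ρ₀)(s − (1 − ρ₀))·V = (2ρ₀ − 1)·ξ`
in the closed strip and `ξ(ρ₀) = 0`, then `V ≠ R·ξ` on the open strip for any `R` continuous at `ρ₀` (near `ρ₀`,
`ξ ≠ 0` off `ρ₀`, so `(s − ρ₀)(s − (1 − ρ₀))R(s) = 2ρ₀ − 1 → 0`, contradicting `ξ(1/2) ≠ 0`). [folklore] -/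
theorem not_exists_continuous_quotient {ρ₀ : ℂ} (h0 : 0 < ρ₀.re) (h1 : ρ₀.re < 1)
    (hξ : riemannXi ρ₀ = 0) {V : ℂ → ℂ}
    (hkey : ∀ s : ℂ, 0 ≤ s.re → s.re ≤ 1 → (s - ρ₀) * (s - (1 - ρ₀)) * V s = (2 * ρ₀ - 1) * riemannXi s) :
    ¬ ∃ R : ℂ → ℂ, ContinuousAt R ρ₀ ∧ ∀ s : ℂ, 0 < s.re → s.re < 1 → V s = R s * riemannXi s := by
  rintro ⟨R, hR, hVR⟩
  have hξa : AnalyticAt ℂ riemannXi ρ₀ := differentiable_riemannXi.analyticAt ρ₀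
  -- `ξ ≠ 0` on a punctured neighbourhood of `ρ₀`
  have hne : ∀ᶠ s in 𝓝[≠] ρ₀, riemannXi s ≠ 0 := by
    rcases hξa.eventually_eq_zero_or_eventually_ne_zero with h | h
    · exfalso
      have hall := AnalyticOnNhd.eqOn_zero_of_preconnected_of_eventuallyEq_zero
        (fun z _ => differentiable_riemannXi.analyticAt z) isPreconnected_univ (mem_univ ρ₀) h
      have h0' := hall (mem_univ (0 : ℂ))
      rw [riemannXi_zero, Pi.zero_apply] at h0'
      norm_num at h0'
    · exact h
  have hU : {z : ℂ | 0 < z.re ∧ z.re < 1} ∈ 𝓝 ρ₀ :=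
    (isOpen_Ioo.preimage Complex.continuous_re).mem_nhds ⟨h0, h1⟩
  have hev : ∀ᶠ s in 𝓝[≠] ρ₀, (2 * ρ₀ - 1 : ℂ) = (s - ρ₀) * (s - (1 - ρ₀)) * R s := by
    filter_upwards [hne, mem_nhdsWithin_of_mem_nhds hU] with s hs hstrip
    have h := hkey s hstrip.1.le hstrip.2.le
    rw [hVR s hstrip.1 hstrip.2] at h
    exact (mul_right_cancel₀ hs (by linear_combination h)).symm
  have hlim : Tendsto (fun s : ℂ => (s - ρ₀) * (s - (1 - ρ₀)) * R s) (𝓝[≠] ρ₀)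
      (𝓝 ((ρ₀ - ρ₀) * (ρ₀ - (1 - ρ₀)) * R ρ₀)) :=
    (((continuousAt_id.sub continuousAt_const).mul (continuousAt_id.sub continuousAt_const)).mul
      hR).tendsto.mono_left nhdsWithin_le_nhds
  rw [sub_self, zero_mul, zero_mul] at hlim
  have hconst : Tendsto (fun s : ℂ => (s - ρ₀) * (s - (1 - ρ₀)) * R s) (𝓝[≠] ρ₀) (𝓝 (2 * ρ₀ - 1)) :=
    tendsto_const_nhds.congr' hev
  have h01 : (2 * ρ₀ - 1 : ℂ) = 0 := tendsto_nhds_unique hconst hlim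
  have hρ : ρ₀ = 1 / 2 := by linear_combination h01 / 2
  exact riemannXi_one_half_ne_zero (hρ ▸ hξ)

/-! ## §5 Consequences for «Hardy rigidity» (idea-3 §G24-3, H-RIG) -/

/-- **H-RIG(2) FAILS AT A MULTIPLE ZERO** (`ξ(ρ₀) = ξ′(ρ₀) = 0`): «every smooth, even, strong-class, harmonic
`v` with the order-2 rate-`π` tail is a multiple of `Φ`» is FALSE (§4); fewer hypotheses a fortiori. [folklore] -/
theorem not_hardyRigidity_of_multiple_zero {ρ₀ : ℂ} (h0 : 0 < ρ₀.re) (h1 : ρ₀.re < 1)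
    (hξ : riemannXi ρ₀ = 0) (hξ' : deriv riemannXi ρ₀ = 0) :
    ¬ ∀ v : ℝ → ℂ, ContDiff ℝ (⊤ : ℕ∞) v → (∀ t, v (-t) = v t) →
        (∀ k : ℕ, ∃ C : ℝ, ∀ t : ℝ, ‖iteratedDeriv k v t‖ ≤ C * Real.exp (-(1 * |t|))) →
        (∃ C : ℝ, ∀ t : ℝ,
          ‖v t‖ ≤ C * (1 + Real.exp (2 * |t|)) ^ 2 * Real.exp (|t| / 2 - π * Real.exp (2 * |t|))) →
        (∀ g : ℝ → ℂ, IsWeilTest g → weilFunctional (weilConv v (weilReflect g)) = 0) →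
        ∃ c : ℂ, ∀ t : ℝ, v t = c * ((2 : ℂ) * LagariasMontague.Psic (2 * t)) := by
  intro H
  obtain ⟨v, hcd, hev, hb, htail, hharm, -, -, hnot⟩ :=
    exists_harmonic_gaussTail_not_const_mul_phi h0 h1 hξ hξ'
  obtain ⟨c, hc⟩ := H v hcd hev hb htail hharm
  exact hnot c hc

/-- **«HARDY RIGIDITY» IMPLIES THE SIMPLE ZEROS CONJECTURE.** If every smooth, even, strong-class, harmonic
`v` with `‖v(t)‖ ≤ C(1 + e^{2|t|})² e^{|t|/2 − πe^{2|t|}}` is a multiple of `Φ = 2Ψ(2·)` (idea-3 g24's H-RIG(2) over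
the tree's harmonic predicate), then every non-trivial zero of `ζ` is simple (`SimpleZerosConjecture`): the
offer is ≥ SZC; Hardy enters only once «harmonic» (values) is upgraded to «`ξ ∣ v̂`» (multiplicities). [folklore] -/
theorem simpleZerosConjecture_of_hardyRigidity
    (H : ∀ v : ℝ → ℂ, ContDiff ℝ (⊤ : ℕ∞) v → (∀ t, v (-t) = v t) →
        (∀ k : ℕ, ∃ C : ℝ, ∀ t : ℝ, ‖iteratedDeriv k v t‖ ≤ C * Real.exp (-(1 * |t|))) →
        (∃ C : ℝ, ∀ t : ℝ,
          ‖v t‖ ≤ C * (1 + Real.exp (2 * |t|)) ^ 2 * Real.exp (|t| / 2 - π * Real.exp (2 * |t|))) →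
        (∀ g : ℝ → ℂ, IsWeilTest g → weilFunctional (weilConv v (weilReflect g)) = 0) →
        ∃ c : ℂ, ∀ t : ℝ, v t = c * ((2 : ℂ) * LagariasMontague.Psic (2 * t))) :
    SimpleZerosConjecture := by
  intro ρ hρ hζ'
  have hmem : ρ ∈ ZetaZeros.riemannZetaNontrivialZeros := hρ
  obtain ⟨hζ, h0, h1⟩ := mem_riemannZetaNontrivialZeros_iff_holds.1 hmem
  have hξ : riemannXi ρ = 0 := riemannXi_eq_zero_of_mem_riemannZetaNontrivialZeros hmem
  have hne1 : ρ ≠ 1 := ZetaZeros.riemannZetaNontrivialZeros.ne_one hmem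
  have hξ' : deriv riemannXi ρ = 0 := by
    rw [Literature.Barriers.RiemannHypothesis.deriv_riemannXi_eq_of_zero h0 hne1 hζ, hζ', mul_zero]
  exact not_hardyRigidity_of_multiple_zero h0 h1 hξ hξ' H

/-! ## §6 idea-3 g25's typed statements (HOME-only file, sha16 642ee450…), unfolded verbatim and PROVED -/
/-- A polynomial whose coefficients vanish in every degree `k` with `2 ≤ k + 1` is the constant `P₀`. [folklore] -/
theorem polynomial_eq_C_of_coeff_succ_eq_zero {P : Polynomial ℂ} (hP : ∀ k : ℕ, 2 ≤ k + 1 → P.coeff k = 0) :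
    P = Polynomial.C (P.coeff 0) := by
  ext k
  rcases k with _ | k
  · simp
  · rw [Polynomial.coeff_C, if_neg (Nat.succ_ne_zero k)]
    exact hP (k + 1) (by omega)

/-- **idea-3 g25's `HRigValueForcesSimpleZeros`, PROVED** (`HRigValue 2`, `GaussTail 2`, `IsWeilHarmonic`, `MellinLadder 2`
unfolded verbatim): the VALUE-level rigidity at order 2 forces `ξ′(ρ) ≠ 0` at every non-trivial zero. [folklore] -/
theorem hRigValue_two_forces_simple_zeros
    (H : ∀ v : ℝ → ℂ, Measurable v →
      (∃ C : ℝ, ∀ t : ℝ,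
        ‖v t‖ ≤ C * (1 + Real.exp (2 * |t|)) ^ 2 * Real.exp (|t| / 2 - π * Real.exp (2 * |t|))) →
      (∀ g : ℝ → ℂ, IsWeilTest g → weilFunctional (weilConv v (weilReflect g)) = 0) →
      ∃ P : Polynomial ℂ, (∀ k : ℕ, 2 ≤ k + 1 → P.coeff k = 0) ∧
        ∀ s : ℂ, weilMellin v s = P.eval s * riemannXi s)
    {ρ : ℂ} (hρ : ρ ∈ ZetaZeros.riemannZetaNontrivialZeros) : deriv riemannXi ρ ≠ 0 := by
  intro hξ'
  have h0 := ZetaZeros.riemannZetaNontrivialZeros.re_pos hρ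
  have h1 := ZetaZeros.riemannZetaNontrivialZeros.re_lt_one hρ
  have hξ := riemannXi_eq_zero_of_mem_riemannZetaNontrivialZeros hρ
  obtain ⟨v, hcd, -, -, htail, hharm, -, hnotmel, -⟩ :=
    exists_harmonic_gaussTail_not_const_mul_phi h0 h1 hξ hξ'
  obtain ⟨P, hP, hvP⟩ := H v hcd.continuous.measurable htail hharm
  refine hnotmel (P.coeff 0) fun s _ _ => ?_
  rw [hvP s, polynomial_eq_C_of_coeff_succ_eq_zero hP, Polynomial.eval_C, Polynomial.coeff_C_zero]

/-- **idea-3 g25's bridge `HarmonicDivides 2` FAILS at a multiple zero** (unfolded verbatim): if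
`ξ(ρ₀) = ξ′(ρ₀) = 0` in the open strip, not every measurable Weil-harmonic `v` of the order-2 rate-`π` class
has `v̂ = m·ξ` with `m` entire — the witness's `v̂/ξ` has a pole at `ρ₀` (converse under simple zeros: file XX-c
`HandoffHarmonicDivides`). [folklore] -/
theorem not_harmonicDivides_two_of_multiple_zero {ρ₀ : ℂ} (h0 : 0 < ρ₀.re) (h1 : ρ₀.re < 1)
    (hξ : riemannXi ρ₀ = 0) (hξ' : deriv riemannXi ρ₀ = 0) :
    ¬ ∀ v : ℝ → ℂ, Measurable v →
      (∃ C : ℝ, ∀ t : ℝ,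
        ‖v t‖ ≤ C * (1 + Real.exp (2 * |t|)) ^ 2 * Real.exp (|t| / 2 - π * Real.exp (2 * |t|))) →
      (∀ g : ℝ → ℂ, IsWeilTest g → weilFunctional (weilConv v (weilReflect g)) = 0) →
      ∃ m : ℂ → ℂ, Differentiable ℂ m ∧ ∀ s : ℂ, weilMellin v s = m s * riemannXi s := by
  intro H
  obtain ⟨v, hcd, -, -, htail, hharm, hkey, -, -⟩ :=
    exists_harmonic_gaussTail_not_const_mul_phi h0 h1 hξ hξ'
  obtain ⟨m, hm, hvm⟩ := H v hcd.continuous.measurable htail hharm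
  exact not_exists_continuous_quotient h0 h1 hξ hkey
    ⟨m, (hm ρ₀).continuousAt, fun s _ _ => hvm s⟩

end Summit.RiemannHypothesis.RiemannHypothesis.Theorems.HandoffHardyRigidity

end
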